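import Literature.Analysis.FluidPDE.NSLerayHopfSereginEnergyProofs
import Literature.Analysis.FluidPDE.KatoFarFieldBound
import Literature.Analysis.FluidPDE.NSLerayExistenceR3Holds
import Literature.Analysis.FluidPDE.LerayLocalRegularH1Proofs
import Literature.Analysis.FluidPDE.RusinSverakLeraySolutions
import Summits.NavierStokesRegularity.NavierStokesRegularity.Theorems.TypeICertificateLadderNoBlowupToClayLemmas

/-! # Leray–Hopf maximal development of a datum without Tao-class solution on `[0, T]` —
crux stmt-NavierStokesRegularity-0727 (`CertifiedBlowup.CertifiedBlowupAxisymBlowup`), line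
`compact-amplification`, stub `stub_maximal`

PROVED, exactly as registered: for `ν > 0`, `T > 0` and a smooth, divergence-free, rapidly
decaying datum `u₀ : ℝ³ → ℝ³` admitting NO Tao-class solution (`IsTaoSolutionOn`) on the closed
slab `[0, T]`, there are a lifespan `T*`, `0 < T* ≤ T`, and a pair `(u, p)` with `u 0 = u₀` which
is a maximal smooth solution of the unforced Navier–Stokes system with lifespan `T*`
(`IsMaximalSmoothSolution`: classical on `ℝ³ × [0, T*)`, no classical continuation past `T*`) and
Leray–Hopf on `[0, T*]` from `u₀` (`IsLerayHopfOn`).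

**Proof** (bookkeeping over engines proved in the tree; adapted from
`Theorems/TypeICertificateLadderNoBlowupToClay.lean`). The datum lies in `L² ∩ L³` and is weakly
divergence free, so its Kato maximal time `T_max = katoMaximalTime ν u₀` is positive
(`katoMaximalTime_pos`, `kato_local_holds`). It is at most `T`: otherwise a Kato solution lives
on some `[0, T'')`, `T < T''` (`exists_isKatoSolutionOn_of_lt_katoMaximalTime`), and von Wahl's
regularity of the class `C_t L³_x` (`exists_isTaoSolutionOn_of_isKatoSolutionOn`) produces a
Tao-class solution on `[0, T]` — excluded. Put `T* = T_max ∈ (0, T]`. The maximal Kato solution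
`w` on `[0, T*)` (`exists_isKatoSolutionOn_katoMaximalTime`, `kato_unique_holds`) has a singular
point `(T*, x₁)`: it is essentially unbounded on every backward parabolic cylinder `Q_r(T*, x₁)`
(`lemarieRieusset_singular_point_of_blowup_holds`, Lemarié-Rieusset 2016, Thm. 15.1 (C)).
Tao-class solutions from `u₀` exist on `[0, Tₙ]`, `Tₙ ↑ T*`; they patch to a classical solution
`(U, P)` on `[0, T*)` with `U 0 = u₀` (`exists_classical_of_isTaoSolutionOn_family`) and
`U(t) = w(t)` a.e. (`IsTaoSolutionOn.ae_eq_of_kato`). Graft Leray's global weak solution `v`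
from `u₀` (`leray_existence_R3_holds`) at `T*`: since `v(t) = U(t)` a.e. for `0 < t < T*`
(Prodi–Serrin, `weak_strong_uniqueness_holds`), the field `V = U` on `[0, T*)`, `V = v` from `T*`
on, is Leray–Hopf on `[0, T*]` from `u₀` (`IsLerayHopfOn.congr_ae_slices`, after resetting the
unconstrained slice `v 0` to `u₀` by `isLerayHopfOn_update_initial`) and classical on `[0, T*)`
(`IsClassicalNSSolutionOn.congr_slices`). Maximality: a classical continuation `u'` of `V` to
`[0, T')`, `T' > T*`, is jointly continuous, hence bounded on the compact
`[T*/2, T*] × B̄(x₁, 1)`, so `U = V = u'` is bounded on a small cylinder `Q_r(T*, x₁)` —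
contradicting the singular point, transferred from `w` to `U` along the a.e. equality
(`ae_restrict_prod_of_forall_ae_eq`, `eLpNorm_parabolicCylinder_eq_top_of_ae_eq`).

## References

* J. Leray, Acta Math. 63 (1934), §III and Ch. V §§31–34 (solutions turbulentes, structure).
* T. Tao, *Localisation and compactness properties of the Navier–Stokes global regularity
  problem*, Anal. PDE 6 (2013), Thm. 5.4, Thm. 10.1, Cor. 11.1.
* P. G. Lemarié-Rieusset, *The Navier–Stokes Problem in the 21st Century*, CRC 2016, Thm. 7.2,
  Prop. 12.3, Thm. 15.1 (C).
* J. C. Robinson, J. L. Rodrigo, W. Sadowski, *The Three-Dimensional Navier–Stokes Equations*,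
  CUP 2016, Thm. 8.19 (weak–strong uniqueness).
* T. Kato, Math. Z. 187 (1984), Thms. 1, 4.
-/

set_option linter.dupNamespace false

noncomputable section

open MeasureTheory Set Function Filter Topology Metric
open scoped ENNReal NNReal ContDiff InnerProductSpace RealInnerProductSpace Laplacian

namespace Summit.NavierStokesRegularity.NavierStokesRegularity.Theorems.CertifiedBlowupAxisymBlowup.CompactAmplification

open Literature.Analysis.FluidPDE

local notation "ℝ³" => EuclideanSpace ℝ (Fin 3)

-- adapted from Theorems/TypeICertificateLadderNoBlowupToClay.lean
-- (`typeICertificateLadder_noBlowupToClay_proof`, the finite-maximal-time branch)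

/-- **Leray–Hopf maximal development** (Leray 1934 §§31–34; Tao 2013 Thm 5.4, Thm 10.1,
Cor 11.1; Lemarié-Rieusset 2016 Thm. 15.1 (C)): if a smooth divergence-free rapidly decaying datum
`u₀` admits NO Tao-class solution on `[0, T]`, `T > 0`, then it launches a maximal smooth solution
of the unforced Navier–Stokes system with finite lifespan `T* ≤ T` which attains `u₀` at `t = 0`
and is Leray–Hopf on `[0, T*]` from `u₀`. Here `T*` is the Kato maximal time of `u₀` (at most `T`
by von Wahl's regularity of `C_t L³_x`), the solution is the patched family of Tao-class solutions
below `T*` grafted with Leray's weak solution at `T*`, and maximality comes from the singular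
point of the maximal Kato solution at `t = T*`. See the module docstring. -/
theorem stub_maximal :
    ∀ ν : ℝ, 0 < ν → ∀ T : ℝ, 0 < T → ∀ (u₀ : ℝ³ → ℝ³), ContDiff ℝ ∞ u₀ →
      VectorCalculus.IsDivFree u₀ → HasRapidSpatialDecay u₀ →
      (¬ ∃ (u : ℝ → ℝ³ → ℝ³) (p : ℝ → ℝ³ → ℝ), IsTaoSolutionOn T ν u₀ u p) →
      ∃ Tstar : ℝ, 0 < Tstar ∧ Tstar ≤ T ∧ ∃ (u : ℝ → ℝ³ → ℝ³) (p : ℝ → ℝ³ → ℝ),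
        u 0 = u₀ ∧ IsMaximalSmoothSolution ν 0 u p Tstar ∧ IsLerayHopfOn Tstar ν 0 u₀ u := by
  intro ν hν T hT u₀ hsm hdiv hdec hno
  classical
  /- ### the datum: `H^∞`, `L²`, `L³`, weakly divergence free -/
  have hHk : ∀ n : ℕ, ∫⁻ x, ‖iteratedFDeriv ℝ n u₀ x‖ₑ ^ 2 < ⊤ :=
    hdec.lintegral_enorm_iteratedFDeriv_sq_lt_top
  have hmeas0 : AEStronglyMeasurable u₀ volume := hsm.continuous.aestronglyMeasurable
  have hL2 : ∫⁻ x, ‖u₀ x‖ₑ ^ 2 < ⊤ := by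
    refine lt_of_le_of_lt (le_of_eq (lintegral_congr fun x => ?_)) (hHk 0)
    rw [← ofReal_norm, ← ofReal_norm, norm_iteratedFDeriv_zero]
  have hu2 : MemLp u₀ 2 volume := ⟨hmeas0, eLpNorm_two_lt_top_of_lintegral_enorm_sq_lt_top hL2⟩
  obtain ⟨C₀, hC₀⟩ := hdec 0 0
  have hbd0 : ∀ x, ‖u₀ x‖ ≤ C₀ := fun x => by
    have h := hC₀ x
    rwa [pow_zero, one_mul, norm_iteratedFDeriv_zero] at h
  have hu3 : MemLp u₀ 3 volume := by
    refine ⟨hmeas0, ?_⟩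
    have h3 : eLpNorm u₀ 3 volume ^ 3 ≤ eLpNorm u₀ ⊤ volume * eLpNorm u₀ 2 volume ^ 2 :=
      eLpNorm_three_pow_le hmeas0
    have htop : eLpNorm u₀ ⊤ volume ≤ ENNReal.ofReal C₀ := eLpNorm_top_le_of_bound hbd0
    have hfin : eLpNorm u₀ ⊤ volume * eLpNorm u₀ 2 volume ^ 2 < ⊤ :=
      ENNReal.mul_lt_top (htop.trans_lt ENNReal.ofReal_lt_top)
        (ENNReal.pow_lt_top hu2.eLpNorm_lt_top)
    by_contra hnot
    rw [not_lt, top_le_iff] at hnot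
    rw [hnot, ENNReal.top_pow (by norm_num)] at h3
    exact absurd (h3.trans_lt hfin) (lt_irrefl _)
  have hdivW : NSWave0.IsDivFree u₀ := fun x => hdiv x
  have hwdiv : IsWeaklyDivFree u₀ :=
    VectorCalculus.IsDivFree.isWeaklyDivFree_holds hdiv (hsm.of_le (mod_cast le_top))
  /- ### the Kato maximal time: positive, and at most `T` (no Tao-class solution on `[0, T]`) -/
  have hTm0 : 0 < katoMaximalTime ν u₀ := katoMaximalTime_pos kato_local_holds hν hu3 hwdiv
  have hleT : katoMaximalTime ν u₀ ≤ ENNReal.ofReal T := by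
    by_contra hlt
    rw [not_le] at hlt
    -- a Kato solution on `[0, T'')`, `T < T''`, upgrades to a Tao-class solution on `[0, T]`
    obtain ⟨T'', hTT'', w', hw'⟩ := exists_isKatoSolutionOn_of_lt_katoMaximalTime hlt
    have hTT : T < T'' := (ENNReal.ofReal_lt_ofReal_iff'.1 hTT'').1
    obtain ⟨u, p, hup⟩ :=
      exists_isTaoSolutionOn_of_isKatoSolutionOn hν hsm hdivW hdec hw' hT hTT
    exact hno ⟨u, p, hup⟩
  have htop' : katoMaximalTime ν u₀ < ⊤ := hleT.trans_lt ENNReal.ofReal_lt_top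
  -- the maximal Kato solution `w` on `[0, Tm)`, `Tm = T_max ≤ T`
  obtain ⟨w, hw⟩ := exists_isKatoSolutionOn_katoMaximalTime kato_unique_holds hν hTm0 htop'
  set Tm : ℝ := (katoMaximalTime ν u₀).toReal with hTm_def
  have hT0 : 0 < Tm := ENNReal.toReal_pos hTm0.ne' htop'.ne
  have hTmT : Tm ≤ T := ENNReal.toReal_le_of_le_ofReal hT.le hleT
  have hofReal : ENNReal.ofReal Tm = katoMaximalTime ν u₀ := ENNReal.ofReal_toReal htop'.ne
  have hmax : ∀ T'' : ℝ, Tm < T'' → ∀ w' : ℝ → ℝ³ → ℝ³, ¬ IsKatoSolutionOn T'' ν u₀ w' :=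
    fun T'' hT'' w' => not_isKatoSolutionOn_of_katoMaximalTime_lt (by
      rw [← hofReal]
      exact (ENNReal.ofReal_lt_ofReal_iff (hT0.trans hT'')).2 hT'')
  -- its singular point `(Tm, x₁)`
  obtain ⟨x₁, hx₁⟩ := lemarieRieusset_singular_point_of_blowup_holds hν hT0 hu3 hwdiv hw hmax
  have hall : ∀ r : ℝ, 0 < r →
      eLpNorm (uncurry w) ⊤ (volume.restrict (parabolicCylinder r ((Tm : ℝ), x₁))) = ⊤ :=
    fun r hr => eLpNorm_top_parabolicCylinder_eq_top_of_small hT0 hx₁ hr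
  /- ### the classical representative on `[0, Tm)`: patched Tao-class solutions -/
  set Ts : ℕ → ℝ := fun n => Tm - Tm / ((n : ℝ) + 2) with hTs_def
  have hTs0 : ∀ n, 0 < Ts n := fun n => by
    have h1 : Tm / ((n : ℝ) + 2) < Tm := by
      rw [div_lt_iff₀ (by positivity)]
      nlinarith
    simp only [hTs_def]
    linarith
  have hTsT : ∀ n, Ts n < Tm := fun n => by
    have h1 : 0 < Tm / ((n : ℝ) + 2) := by positivity
    simp only [hTs_def]
    linarith
  have hcof : ∀ t < Tm, ∃ n, t < Ts n := fun t ht => by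
    obtain ⟨n, hn⟩ := exists_nat_gt (Tm / (Tm - t))
    refine ⟨n, ?_⟩
    have hpos : 0 < Tm - t := sub_pos.2 ht
    have h1 : Tm < ((n : ℝ) + 2) * (Tm - t) := by
      rw [div_lt_iff₀ hpos] at hn
      nlinarith
    have h2 : Tm / ((n : ℝ) + 2) < Tm - t := by
      rw [div_lt_iff₀ (by positivity)]
      linarith
    simp only [hTs_def]
    linarith
  have hex : ∀ n, ∃ (u : ℝ → ℝ³ → ℝ³) (p : ℝ → ℝ³ → ℝ), IsTaoSolutionOn (Ts n) ν u₀ u p :=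
    fun n => exists_isTaoSolutionOn_of_isKatoSolutionOn hν hsm hdivW hdec hw (hTs0 n) (hTsT n)
  choose u p hup using hex
  obtain ⟨U, P, hcl, hU0, hUeq⟩ :=
    exists_classical_of_isTaoSolutionOn_family hν hTs0 (fun n => (hTsT n).le) hcof hup
  -- `U` agrees a.e. with the Kato solution `w` on every slice of `[0, Tm)`
  have hUw : ∀ t ∈ Ico 0 Tm, U t =ᵐ[volume] w t := by
    intro t ht
    obtain ⟨n, hn⟩ := hcof t ht.2
    rw [(hUeq n t ⟨ht.1, hn⟩).1]
    have hwn : IsKatoSolutionOn (Ts n) ν u₀ w := hw.mono (hTsT n).le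
    exact (hup n).ae_eq_of_kato hν hwn.mild hwn.continuousInLpOn hwn.aestronglyMeasurable
      t ⟨ht.1, hn⟩
  -- `U` is measurable on the strip
  have hUm : AEStronglyMeasurable (uncurry U) (volume.restrict (Ioo 0 Tm ×ˢ univ)) :=
    (hcl.smooth_velocity.continuousOn.mono
      (prod_mono Ioo_subset_Ico_self Subset.rfl)).aestronglyMeasurable
      (measurableSet_Ioo.prod MeasurableSet.univ)
  /- ### Leray's weak solution, grafted at `Tm` -/
  obtain ⟨v, hv⟩ := leray_existence_R3_holds ν hν u₀ hu2 hwdiv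
  -- `v(t) = U(t)` a.e. for `0 < t < Tm` (Prodi–Serrin, through the Tao-class solutions)
  have hvU : ∀ t ∈ Ioo 0 Tm, v t =ᵐ[volume] U t := by
    intro t ht
    obtain ⟨n, hn⟩ := hcof t ht.2
    rw [(hUeq n t ⟨ht.1.le, hn⟩).1]
    have hLH : IsLerayHopfOn (Ts n) ν 0 u₀ (u n) := (hup n).isLerayHopfOn (hTs0 n)
    obtain ⟨B, -, hB⟩ := (hup n).exists_bound_velocity
    have hSer : MemLqLp ⊤ ⊤ (u n) (Ioo 0 (Ts n)) :=
      memLqLp_top_top_of_bound (fun s hs => (hup n).aestronglyMeasurable_slice hs) hB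
    exact weak_strong_uniqueness_holds hν (hTs0 n) hLH (q := ⊤) (r := ⊤) ENNReal.ofNat_lt_top
      (by simp [ENNReal.div_top]) hSer (hv.isLerayHopfOn (hTs0 n)) t ⟨ht.1, hn.le⟩
  -- reset the unconstrained slice `v 0`
  set v' : ℝ → ℝ³ → ℝ³ := fun t => if t = 0 then u₀ else v t with hv'_def
  have hLHv' : IsLerayHopfOn Tm ν 0 u₀ v' :=
    isLerayHopfOn_update_initial (hv.isLerayHopfOn hT0) hu2
  -- the grafted field
  set V : ℝ → ℝ³ → ℝ³ := fun t => if t < Tm then U t else v t with hV_def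
  have hVlt : ∀ {t : ℝ}, t < Tm → V t = U t := fun {t} ht => by simp only [hV_def, if_pos ht]
  have hV0 : V 0 = u₀ := by rw [hVlt hT0, hU0]
  have hVm : AEStronglyMeasurable (uncurry V) (volume.restrict (Ioo 0 Tm ×ˢ univ)) := by
    refine hUm.congr ?_
    filter_upwards [ae_restrict_mem (measurableSet_Ioo.prod MeasurableSet.univ)] with z hz
    obtain ⟨t, x⟩ := z
    simp only [uncurry_apply_pair, hVlt (show t < Tm from hz.1.2)]
  have hVeq : ∀ t ∈ Icc 0 Tm, V t =ᵐ[volume] v' t := by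
    intro t ht
    rcases eq_or_lt_of_le ht.1 with h0 | hpos
    · subst h0
      rw [hV0]
      simp [hv'_def]
    have hv't : v' t = v t := by simp only [hv'_def, if_neg hpos.ne']
    rw [hv't]
    rcases lt_or_eq_of_le ht.2 with hlt | heq
    · rw [hVlt hlt]
      exact (hvU t ⟨hpos, hlt⟩).symm
    · subst heq
      simp only [hV_def, lt_irrefl, if_false]
      exact Filter.EventuallyEq.rfl
  have hLHV : IsLerayHopfOn Tm ν 0 u₀ V := hLHv'.congr_ae_slices hT0 hVm hVeq
  have hclV : IsClassicalNSSolutionOn (Ico 0 Tm) ν 0 V P :=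
    hcl.congr_slices (fun t ht => hVlt ht.2) fun t _ => rfl
  /- ### the witness; maximality from the singular point `(Tm, x₁)` -/
  refine ⟨Tm, hT0, hTmT, V, P, hV0, ⟨hclV, ?_⟩, hLHV⟩
  rintro ⟨T', hTT', u', p', hcl', hagree⟩
  -- the continuation is bounded on the compact `[Tm/2, Tm] × B̄(x₁, 1)`
  set K : Set (ℝ × ℝ³) := Icc (Tm / 2) Tm ×ˢ closedBall x₁ 1 with hK_def
  have hK : IsCompact K := isCompact_Icc.prod (isCompact_closedBall _ _)
  have hKsub : K ⊆ Ico 0 T' ×ˢ (univ : Set ℝ³) :=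
    prod_mono (fun t ht => ⟨by linarith [ht.1], ht.2.trans_lt hTT'⟩) (subset_univ _)
  have hcont : ContinuousOn (uncurry u') K := hcl'.smooth_velocity.continuousOn.mono hKsub
  obtain ⟨M, hM⟩ := hK.exists_bound_of_continuousOn hcont
  -- a small cylinder `Q_r(Tm, x₁) ⊆ K`, `r ≤ 1`, `r² ≤ Tm/2`
  set r : ℝ := min 1 (Real.sqrt (Tm / 2)) with hr_def
  have hr0 : 0 < r := lt_min one_pos (Real.sqrt_pos.2 (by positivity))
  have hr1 : r ≤ 1 := min_le_left _ _
  have hr2 : r ^ 2 ≤ Tm / 2 := by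
    calc r ^ 2 ≤ Real.sqrt (Tm / 2) ^ 2 := pow_le_pow_left₀ hr0.le (min_le_right _ _) 2
      _ = Tm / 2 := Real.sq_sqrt (by positivity)
  have hcylK : parabolicCylinder r ((Tm : ℝ), x₁) ⊆ K := by
    rintro ⟨s, y⟩ hz
    rw [mem_parabolicCylinder] at hz
    exact ⟨⟨by linarith [hz.1.1], hz.1.2.le⟩, mem_closedBall.2 (hz.2.le.trans hr1)⟩
  -- on the cylinder `U = V = u'`, so `U` is essentially bounded there …
  have hbdU : eLpNorm (uncurry U) ⊤ (volume.restrict (parabolicCylinder r ((Tm : ℝ), x₁))) < ⊤ := by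
    rw [eLpNorm_exponent_top]
    refine eLpNormEssSup_lt_top_of_ae_bound (C := M) ?_
    filter_upwards [ae_restrict_mem (isOpen_parabolicCylinder r ((Tm : ℝ), x₁)).measurableSet]
      with z hz
    have hzK := hcylK hz
    obtain ⟨s, y⟩ := z
    rw [mem_parabolicCylinder] at hz
    have hs : s ∈ Ico 0 Tm := ⟨by linarith [hz.1.1, hr2], hz.1.2⟩
    have heq : uncurry U (s, y) = uncurry u' (s, y) := by
      simp only [uncurry_apply_pair, hagree s hs, hVlt hs.2]
    rw [heq]
    exact hM _ hzK
  -- … while the singularity of `w` at `(Tm, x₁)` transfers to `U`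
  have hUw' : uncurry U =ᵐ[volume.restrict (Ioo 0 Tm ×ˢ (univ : Set ℝ³))] uncurry w :=
    ae_restrict_prod_of_forall_ae_eq (fun t ht => hUw t ⟨ht.1.le, ht.2⟩) hUm
      hw.aestronglyMeasurable
  exact hbdU.ne (eLpNorm_parabolicCylinder_eq_top_of_ae_eq hT0 hUw' x₁ hall hr0)

end Summit.NavierStokesRegularity.NavierStokesRegularity.Theorems.CertifiedBlowupAxisymBlowup.CompactAmplification

end
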